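import Summits.CriticalPhenomena.SAWScalingLimit.Theorems.SAWLeftRightFKGFKGToTraversalBoundSlitNecklaceDefs
import Summits.CriticalPhenomena.SAWScalingLimit.Theorems.SAWLeftRightFKGFKGToTraversalBoundShellIterationGeometry
import HarnessLib

/-!
# Vocabulary of line `slit-necklace`, part 2: spine indices, pieces, index windows (crux `FKGToTraversalBound`, stmt-CriticalPhenomena-1878)

Reshape r3 of the skeleton `Cruxes/FKGToTraversalBound/Lines/slit_necklace.lean` (lead prover-line-stmt-CriticalPhenomena-1878-c4-0,
chart `Cruxes/FKGToTraversalBound/Lines/slit-necklace-chart-r2.md`): the lever `stub_slitNecklace` is split into a deterministic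
BOOKKEEPING stub, a deterministic WITNESS stub (planar topology of hugging routes) and the probabilistic ASSEMBLY.  They all read a chord
`p` (a lattice walk) through its INDEX structure relative to a finite SPINE `Σ` of lattice sites:

* `IsSpineIdx p Sp n` — the `n`-th vertex of `p` is a spine site;
* `IsPiece p Sp i j` — `i < j` are consecutive spine indices with at least one index strictly between: the interior sub-walk
  `p.getVert (i+1) … p.getVert (j-1)` is a maximal run of `p` off the spine (a bead, a strand or the tail of the necklace);
* `HasSepWindows emb p k lo hi y σ₁ σ₂` — `k` STRICTLY SEPARATED index windows `a m ≤ b m` of `p` inside `[lo, hi]` whose end vertices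
  are embedded on opposite sides of the shell `D(y; σ₁, σ₂)` (the index currency of `Curve.HasTraversals` for mesh polylines:
  `ExcursionDomination.ShellIteration.exists_sepIndexTraversals_of_hasTraversals_toCurve` / `hasTraversals_toCurve_of_sepIndexTraversals`,
  p115507);
* `IsFarPiece emb p Σ S i j ca cb η` — a piece one of whose interior vertices is at distance `≥ η` from BOTH marked centres, or which is hung on
  a defect site (`p.getVert i ∈ S` or `p.getVert j ∈ S`): the only pieces that can carry a window across a shell whose band keeps distance
  `≥ 2η` from the marked centres, and the only ones the assembly resamples.

Definitions (predicates with parameters) and small closed API lemmas; no literature fact.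
-/

noncomputable section

open MeasureTheory Filter Topology Set Metric
open scoped NNReal ENNReal
open Literature.Probability.LatticeModels
open Literature.Probability.RandomPlanarGeometry
open Literature.Probability.RandomPlanarGeometry.SAW

namespace Summit.CriticalPhenomena.SAWScalingLimit.Theorems.FKGToTraversalBound.SlitNecklace

section Pieces

variable {V : Type*} {G : SimpleGraph V} {u v : V} {E : Type*} [PseudoMetricSpace E]

/-- The `n`-th vertex of the walk `p` (`n ≤ p.length`) is a SPINE site. [folklore] -/
def IsSpineIdx (p : G.Walk u v) (Sp : Set V) (n : ℕ) : Prop :=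
  n ≤ p.length ∧ p.getVert n ∈ Sp

/-- `i < j` delimit a PIECE of `p` off the spine `Σ`: both are spine indices, `i + 2 ≤ j`, and no index strictly between them is a
spine index; the interior vertices `p.getVert n`, `i < n < j`, form a maximal run of `p` off `Σ`. [folklore] -/
def IsPiece (p : G.Walk u v) (Sp : Set V) (i j : ℕ) : Prop :=
  IsSpineIdx p Sp i ∧ IsSpineIdx p Sp j ∧ i + 2 ≤ j ∧ ∀ n, i < n → n < j → p.getVert n ∉ Sp

/-- `k` STRICTLY SEPARATED INDEX WINDOWS of `p` inside `[lo, hi]` across the shell `D(y; σ₁, σ₂)`: windows `a m ≤ b m` in `[lo, hi]`,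
`b m < a m'` for `m < m'`, whose end vertices are embedded (by `emb`) on opposite sides of the shell — one within `σ₁` of `y`, the
other at distance `≥ σ₂`, in either order. [folklore] -/
def HasSepWindows (emb : V → E) (p : G.Walk u v) (k lo hi : ℕ) (y : E) (σ₁ σ₂ : ℝ) : Prop :=
  ∃ a b : Fin k → ℕ, (∀ m, lo ≤ a m ∧ a m ≤ b m ∧ b m ≤ hi) ∧
    (∀ m, (dist (emb (p.getVert (a m))) y ≤ σ₁ ∧ σ₂ ≤ dist (emb (p.getVert (b m))) y) ∨
      (σ₂ ≤ dist (emb (p.getVert (a m))) y ∧ dist (emb (p.getVert (b m))) y ≤ σ₁)) ∧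
    ∀ ⦃m m' : Fin k⦄, m < m' → b m < a m'

/-- A FAR piece (for the marked centres `ca`, `cb`, the reach `η` and the defect set `S`): a piece hung on a defect site, or one of whose
interior vertices is embedded at distance `≥ η` from both marked centres. [folklore] -/
def IsFarPiece (emb : V → E) (p : G.Walk u v) (Sp : Set V) (S : Set V) (i j : ℕ) (ca cb : E) (η : ℝ) : Prop :=
  IsPiece p Sp i j ∧ (p.getVert i ∈ S ∨ p.getVert j ∈ S ∨
    ∃ n, i < n ∧ n < j ∧ η ≤ dist (emb (p.getVert n)) ca ∧ η ≤ dist (emb (p.getVert n)) cb)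

/-- Zero windows are always available. [folklore] -/
theorem hasSepWindows_zero (emb : V → E) (p : G.Walk u v) (lo hi : ℕ) (y : E) (σ₁ σ₂ : ℝ) :
    HasSepWindows emb p 0 lo hi y σ₁ σ₂ :=
  ⟨Fin.elim0, Fin.elim0, fun m => m.elim0, fun m => m.elim0, fun m => m.elim0⟩

/-- Fewer windows are easier. [folklore] -/
theorem HasSepWindows.of_le {emb : V → E} {p : G.Walk u v} {k k' lo hi : ℕ} {y : E} {σ₁ σ₂ : ℝ}
    (h : HasSepWindows emb p k lo hi y σ₁ σ₂) (hk : k' ≤ k) : HasSepWindows emb p k' lo hi y σ₁ σ₂ := by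
  obtain ⟨a, b, hab, hside, hsep⟩ := h
  refine ⟨a ∘ Fin.castLE hk, b ∘ Fin.castLE hk, fun m => hab _, fun m => hside _, fun m m' hmm' => hsep ?_⟩
  simpa using hmm'

/-- Windows inside a range are windows inside any larger range. [folklore] -/
theorem HasSepWindows.mono_range {emb : V → E} {p : G.Walk u v} {k lo hi lo' hi' : ℕ} {y : E} {σ₁ σ₂ : ℝ}
    (h : HasSepWindows emb p k lo hi y σ₁ σ₂) (hlo : lo' ≤ lo) (hhi : hi ≤ hi') : HasSepWindows emb p k lo' hi' y σ₁ σ₂ := by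
  obtain ⟨a, b, hab, hside, hsep⟩ := h
  exact ⟨a, b, fun m => ⟨hlo.trans (hab m).1, (hab m).2.1, (hab m).2.2.trans hhi⟩, hside, hsep⟩

/-- Windows across a shell are windows across every thinner concentric shell. [folklore] -/
theorem HasSepWindows.mono_shell {emb : V → E} {p : G.Walk u v} {k lo hi : ℕ} {y : E} {σ₁ σ₂ σ₁' σ₂' : ℝ}
    (h : HasSepWindows emb p k lo hi y σ₁ σ₂) (h₁ : σ₁ ≤ σ₁') (h₂ : σ₂' ≤ σ₂) : HasSepWindows emb p k lo hi y σ₁' σ₂' := by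
  obtain ⟨a, b, hab, hside, hsep⟩ := h
  refine ⟨a, b, hab, fun m => ?_, hsep⟩
  rcases hside m with ⟨h1, h2⟩ | ⟨h1, h2⟩
  · exact Or.inl ⟨h1.trans h₁, h₂.trans h2⟩
  · exact Or.inr ⟨h₂.trans h1, h2.trans h₁⟩

/-- **Registered glue: the whole-walk window currency is the traversal currency.**  For a sub-graph of `ℤ²` drawn at mesh `δ > 0`,
`k` strictly separated index windows of `p` across `D(y; σ₁, σ₂)` give `k` separate traversals of that shell by the mesh polyline
(`ShellIteration.hasTraversals_toCurve_of_sepIndexTraversals`). [folklore] -/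
theorem hasTraversals_of_hasSepWindows :
    ∀ (δ : ℝ) (G : SimpleGraph (Site 2)) (u v : Site 2) (p : G.Walk u v) (k : ℕ) (y : ℂ) (σ₁ σ₂ : ℝ),
      HasSepWindows (meshPoint δ) p k 0 p.length y σ₁ σ₂ →
        (⟨p.toCurve (meshPoint δ)⟩ : Curve ℂ).HasTraversals k y σ₁ σ₂ := by
  intro δ G u v p k y σ₁ σ₂ h
  obtain ⟨a, b, hab, hside, hsep⟩ := h
  exact ExcursionDomination.ShellIteration.hasTraversals_toCurve_of_sepIndexTraversals (meshPoint δ) p a b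
    (fun m => (hab m).2.1) (fun m => (hab m).2.2) hside hsep

end Pieces

/-! ## The two deterministic stubs of reshape r3, as HYPOTHESIS NAMES of the assembly -/

open Summit.CriticalPhenomena.SAWScalingLimit.Theorems.FKGToTraversalBound.Negative (dom)

/-- **NECKLACE BOOKKEEPING** (deterministic; chart r2 steps D2–D3).  For a self-avoiding lattice walk `p` from a site of the
blob `Ka` (sites within `ιa` of the marked centre `ca`) to a site of `Kb`, spine `Ka ∪ Kb ∪ S` with `#S ≤ N₀`, and a shell
`D(x; ρ, R)` whose closed band keeps distance `≥ 2η` from both marked centres (`ιa, ιb < η`, `2η + δ ≤ R − ρ`): if the mesh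
polyline makes `2(N₀ + 2g + (2N₀ + 2g) n₁ + 1)` separate traversals of the shell, then EITHER it makes `g` separate traversals of
the germ shell `D(ca; ιa, η)` (or of `D(cb; ιb, η)`), OR there are fewer than `2N₀ + 2g` far pieces and one of them carries
`n₁ + 1` strictly separated index windows across `D(x; ρ + δ, R − δ)` strictly inside itself.  (Index windows via the
traversal dictionary p115507; windows through a defect index `≤ N₀`; windows through a blob index and far blob-pieces are
charged to the germ shells; the rest lie inside pieces, which are then far by a discrete intermediate value; pigeonhole.)
(HYPOTHESIS NAME of the line — a definition used as a stub conclusion/hypothesis, not a literature fact; provable now.) -/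
def NecklaceBookkeeping : Prop :=
  ∀ (δ : ℝ) (G : SimpleGraph (Site 2)) (u v : Site 2) (p : G.Walk u v) (Ka Kb S : Finset (Site 2)) (ca cb x : ℂ)
    (ιa ιb ρ R η : ℝ) (g n₁ N₀ : ℕ),
    G ≤ zdGraph 2 → p.IsPath → 0 < δ → u ∈ Ka → v ∈ Kb →
    (∀ k ∈ Ka, dist (meshPoint δ k) ca ≤ ιa) → (∀ k ∈ Kb, dist (meshPoint δ k) cb ≤ ιb) → S.card ≤ N₀ →
    ιa < η → ιb < η → 2 * η + δ ≤ R - ρ → ρ + 2 * δ < R - 2 * δ →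
    (∀ z : ℂ, ρ ≤ dist z x → dist z x ≤ R → 2 * η ≤ dist z ca ∧ 2 * η ≤ dist z cb) →
    (⟨p.toCurve (meshPoint δ)⟩ : Curve ℂ).HasTraversals (2 * (N₀ + 2 * g + (2 * N₀ + 2 * g) * n₁ + 1)) x ρ R →
    (⟨p.toCurve (meshPoint δ)⟩ : Curve ℂ).HasTraversals g ca ιa η ∨
    (⟨p.toCurve (meshPoint δ)⟩ : Curve ℂ).HasTraversals g cb ιb η ∨
    ({i : ℕ | ∃ j, IsFarPiece (meshPoint δ) p (↑(Ka ∪ Kb ∪ S)) (↑S) i j ca cb η}.ncard < 2 * N₀ + 2 * g ∧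
      ∃ i j, IsFarPiece (meshPoint δ) p (↑(Ka ∪ Kb ∪ S)) (↑S) i j ca cb η ∧
        HasSepWindows (meshPoint δ) p (n₁ + 1) (i + 1) (j - 1) x (ρ + δ) (R - δ))

/-- **NECKLACE WITNESS** (deterministic planar topology; chart r2 step D5 — the line's own hard lemma).  Fix a Dobrushin domain
and a genuine shell `D(y; σ₁, σ₂)`; there is a constant `nB` (the boundary's crossing budget: separate traversals of a slightly
thinner shell by the Jordan curve, finite and monotone in the margin) such that for all small meshes, every tame presentation
`(C, S)` of `D_δ`, attached spine `Ka ∪ Kb ∪ S` (blobs within `ιa, ιb` of marked centres `ca, cb` which the band of the shell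
avoids by `2η`, `ιa + 3δ ≤ η`, `2η + δ < |ca − cb|`) and every self-avoiding chord `γ` of `D_δ` from `Ka` to `Kb`, the FAR pieces
of `γ` admit a RANK function of height `≤ #far pieces` and, for each far piece `(i, j)` and each bound `W` on the windows (across
the `2δ`-thinner shell) of the far pieces of LOWER rank, a self-avoiding WITNESS `Q` in the presented graph `(dom C δ)_δ` from
`γ_{i+1}` to `γ_{j−1}` avoiding the spine and the rest of `γ` (so: a chord of the piece's hung carrier) with fewer than
`8 (nB + 1) (#far + N₀… + 1) (W + 1)`-many strictly separated windows across `D(y; σ₁, σ₂)` — hugging routes: the blob layer and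
nested children for loops, the left neighbour for strands, the boundary layer for defect-hung pieces and the leftmost strand;
detours round non-far pieces stay within `η + 2δ` of a marked centre and cost nothing.
(HYPOTHESIS NAME of the line — a definition used as a stub conclusion/hypothesis, not a literature fact; OPEN as a formalisation
task, believed true; its failure mode would be a `stub-misstated` with a corrected cost.) -/
def NecklaceWitness : Prop :=
  ∀ (D : DobrushinDomain) (y : ℂ) (σ₁ σ₂ : ℝ), 0 < σ₁ → σ₁ < σ₂ → ∃ nB : ℕ, ∀ᶠ δ in 𝓝[>] (0 : ℝ),
    ∀ (c : Site 2) (C : (zdGraph 2).Walk c c) (S Ka Kb : Finset (Site 2)) (a₀ b₀ : Site 2) (ca cb : ℂ) (ιa ιb η : ℝ)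
      (γ : (discreteDomainGraph D.carrier δ).Walk a₀ b₀),
      (∀ x' y' : Site 2, (discreteDomainGraph (dom C δ) δ).Adj x' y' ↔
        ((discreteDomainGraph D.carrier δ).Adj x' y' ∧ x' ∉ S ∧ y' ∉ S)) →
      (∀ k ∈ Ka ∪ Kb ∪ S, ∃ (q : Site 2) (w : (zdGraph 2).Walk k q), q ∈ C.support ∧
        ∀ z ∈ w.support, z ∈ Ka ∪ Kb ∪ S ∨ z ∈ C.support) →
      γ.IsPath → a₀ ∈ Ka → b₀ ∈ Kb →
      (∀ k ∈ Ka, dist (meshPoint δ k) ca ≤ ιa) → (∀ k ∈ Kb, dist (meshPoint δ k) cb ≤ ιb) →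
      ιa + 3 * δ ≤ η → ιb + 3 * δ ≤ η → 2 * η + δ < dist ca cb → 4 * δ < σ₂ - σ₁ →
      (∀ z : ℂ, σ₁ ≤ dist z y → dist z y ≤ σ₂ → 2 * η ≤ dist z ca ∧ 2 * η ≤ dist z cb) →
      ∃ rk : ℕ → ℕ,
        (∀ i, rk i ≤ {i' : ℕ | ∃ j', IsFarPiece (meshPoint δ) γ (↑(Ka ∪ Kb ∪ S)) (↑S) i' j' ca cb η}.ncard) ∧
        ∀ (i j W : ℕ), IsFarPiece (meshPoint δ) γ (↑(Ka ∪ Kb ∪ S)) (↑S) i j ca cb η →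
          (∀ i' j', IsFarPiece (meshPoint δ) γ (↑(Ka ∪ Kb ∪ S)) (↑S) i' j' ca cb η → rk i' < rk i →
            ¬ HasSepWindows (meshPoint δ) γ (W + 1) (i' + 1) (j' - 1) y (σ₁ + 2 * δ) (σ₂ - 2 * δ)) →
          ∃ Q : (discreteDomainGraph (dom C δ) δ).Walk (γ.getVert (i + 1)) (γ.getVert (j - 1)),
            Q.IsPath ∧
            (∀ z ∈ Q.support, z ∉ (↑(Ka ∪ Kb ∪ S) : Set (Site 2)) ∧
              ∀ n, n ≤ γ.length → (n ≤ i ∨ j ≤ n) → z ≠ γ.getVert n) ∧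
            ¬ HasSepWindows (meshPoint δ) Q
              (8 * (nB + 1) * ({i' : ℕ | ∃ j', IsFarPiece (meshPoint δ) γ (↑(Ka ∪ Kb ∪ S)) (↑S) i' j' ca cb η}.ncard
                + S.card + 1) * (W + 1))
              0 Q.length y σ₁ σ₂

end Summit.CriticalPhenomena.SAWScalingLimit.Theorems.FKGToTraversalBound.SlitNecklace

end
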